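import Literature.MathematicalPhysics.QuantumManyBody.PeriodicBoseGas
import Literature.MathematicalPhysics.QuantumManyBody.BoseGasStructureFactor
import Literature.MathematicalPhysics.QuantumManyBody.PeriodicBoseGasFourier
import HarnessLib

/-!
# Energy bookkeeping of the notch (stub `stub_energyAddConst` of `ModePriceIntegrable`)

Crux `Summit.AtomisticToContinuum.BoseEinsteinCondensation.Theses.BECModePrice.ModePriceIntegrable`
(stmt-AtomisticToContinuum-18512), line Sketch, stub A.

For the periodic `N`-body Bose gas on the cell `[0,L)^{3N}`, a mode `k = 2πm/L`, the density wave
`ρ_k(X) = ∑_j e^{ik·x_j}` (`densityWave`) and a coupling `t ≥ 0`, the identity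
`E(Ψ) + tN²/L³ = F_t(Ψ) + M_t(Ψ)` in `ℝ≥0∞`, where
`F_t(Ψ) = E(Ψ) + (2t/L³) ∫_{cell^N} ∑_{i<j} (1 - cos k·(x_i - x_j)) |Ψ|²` (the notched functional) and
`M_t(Ψ) = (t/L³) ∫_{cell^N} |ρ_k|² |Ψ|²`, GIVEN the pointwise identity
`|ρ_k(X)|² = N + 2∑_{i<j} cos k·(x_i - x_j)` as a hypothesis (it is the neighbouring stub N).

Proof: pointwise `(2t/L³)∑_{i<j}(1 - cos θ_ij) + (t/L³)(N + 2∑_{i<j} cos θ_ij) = (t/L³)(2·#pairs + N)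
= tN²/L³` (`2·#pairs + N = N²`), then additivity/homogeneity of the lower Lebesgue integral
(all integrands are measurable: `Ψ` is `C¹`, `ρ_k` is continuous) and the normalisation
`∫_{cell^N} |Ψ|² = 1`.
-/

noncomputable section

open MeasureTheory
open scoped ENNReal NNReal

namespace Summit.AtomisticToContinuum.BoseEinsteinCondensation.Theorems

open Literature.MathematicalPhysics.QuantumManyBody.BoseGas

/-- Pair count over `Fin N`: `2 · #{(i, j) : i < j} + N = N²`, in `ℝ`. [folklore] -/
theorem energyAddConst_two_mul_sum_add (N : ℕ) :
    2 * (∑ i : Fin N, ∑ j : Fin N with i < j, (1 : ℝ)) + N = (N : ℝ) ^ 2 := by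
  -- adapted from `two_mul_sum_card_filter_lt` (PeriodicBoseGasJastrow): `#{j : i < j} = N - 1 - i`
  have h : ∀ i : Fin N, (∑ j : Fin N with i < j, (1 : ℝ)) = ((N - 1 - (i : ℕ) : ℕ) : ℝ) := fun i => by
    rw [Finset.sum_const, nsmul_eq_mul, mul_one, Finset.filter_lt_eq_Ioi, Fin.card_Ioi]
  simp_rw [h]
  have hnat : 2 * ∑ i : Fin N, (N - 1 - (i : ℕ)) + N = N ^ 2 := by
    have hrefl := Finset.sum_range_reflect (fun i => i) N
    rw [Fin.sum_univ_eq_sum_range (fun i => N - 1 - i) N, hrefl, mul_comm,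
      Finset.sum_range_id_mul_two]
    cases N with
    | zero => rfl
    | succ k => simp only [Nat.add_sub_cancel]; ring
  exact_mod_cast hnat

/-- The real identity behind the bookkeeping:
`(2t/L³) ∑_{i<j} (1 - c_ij) + (t/L³)(N + 2∑_{i<j} c_ij) = tN²/L³`. [folklore] -/
theorem energyAddConst_real (N : ℕ) (t L3 : ℝ) (c : Fin N → Fin N → ℝ) :
    2 * t / L3 * (∑ i : Fin N, ∑ j : Fin N with i < j, (1 - c i j)) +
      t / L3 * ((N : ℝ) + 2 * ∑ i : Fin N, ∑ j : Fin N with i < j, c i j) =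
        t * (N : ℝ) ^ 2 / L3 := by
  have hP := energyAddConst_two_mul_sum_add N
  simp only [Finset.sum_sub_distrib]
  linear_combination (t / L3) * hP

/-- The pointwise identity in `ℝ≥0∞`: if `‖ρ‖² = N + 2∑_{i<j} c_ij` with all `c_ij ≤ 1`, then
`ofReal(2t/L³) · ∑_{i<j} ofReal(1 - c_ij) + ofReal(t/L³) · ‖ρ‖₊² = ofReal(tN²/L³)`. [folklore] -/
theorem energyAddConst_pointwise (N : ℕ) {t L : ℝ} (ht : 0 ≤ t) (hL : 0 < L)
    (c : Fin N → Fin N → ℝ) (hc : ∀ i j, c i j ≤ 1) (ρ : ℂ)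
    (hρ : ‖ρ‖ ^ 2 = (N : ℝ) + 2 * ∑ i : Fin N, ∑ j : Fin N with i < j, c i j) :
    ENNReal.ofReal (2 * t / L ^ 3) * (∑ i : Fin N, ∑ j : Fin N with i < j, ENNReal.ofReal (1 - c i j)) +
      ENNReal.ofReal (t / L ^ 3) * (‖ρ‖₊ : ℝ≥0∞) ^ 2 =
        ENNReal.ofReal (t * (N : ℝ) ^ 2 / L ^ 3) := by
  have h1 : ∀ i j, 0 ≤ 1 - c i j := fun i j => sub_nonneg.mpr (hc i j)
  have hS0 : 0 ≤ ∑ i : Fin N, ∑ j : Fin N with i < j, (1 - c i j) :=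
    Finset.sum_nonneg fun i _ => Finset.sum_nonneg fun j _ => h1 i j
  have hS : (∑ i : Fin N, ∑ j : Fin N with i < j, ENNReal.ofReal (1 - c i j)) =
      ENNReal.ofReal (∑ i : Fin N, ∑ j : Fin N with i < j, (1 - c i j)) := by
    rw [ENNReal.ofReal_sum_of_nonneg fun i _ => Finset.sum_nonneg fun j _ => h1 i j]
    exact Finset.sum_congr rfl fun i _ => (ENNReal.ofReal_sum_of_nonneg fun j _ => h1 i j).symm
  have h2t : 0 ≤ 2 * t / L ^ 3 := by positivity
  have ht3 : 0 ≤ t / L ^ 3 := by positivity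
  rw [hS, coe_nnnorm_sq_eq_ofReal, ← ENNReal.ofReal_mul h2t, ← ENNReal.ofReal_mul ht3,
    ← ENNReal.ofReal_add (mul_nonneg h2t hS0) (mul_nonneg ht3 (sq_nonneg _)), hρ]
  congr 1
  exact energyAddConst_real N t (L ^ 3) c

/-- The abstract integral bookkeeping: if `c₁ A + c₂ B ≡ c` pointwise and `∫ w = 1`, then
`E + c = (E + c₁ ∫ A w) + c₂ ∫ B w` (lower Lebesgue integrals, `A, B, w` measurable). [folklore] -/
theorem energyAddConst_lintegral {α : Type*} [MeasurableSpace α] (μ : Measure α)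
    (E c c₁ c₂ : ℝ≥0∞) {A B w : α → ℝ≥0∞} (hA : Measurable A) (hB : Measurable B)
    (hw : Measurable w) (hnorm : ∫⁻ x, w x ∂μ = 1) (hpt : ∀ x, c₁ * A x + c₂ * B x = c) :
    E + c = (E + c₁ * ∫⁻ x, A x * w x ∂μ) + c₂ * ∫⁻ x, B x * w x ∂μ := by
  have hc : c = ∫⁻ x, c₁ * (A x * w x) + c₂ * (B x * w x) ∂μ := by
    calc c = c * ∫⁻ x, w x ∂μ := by rw [hnorm, mul_one]
      _ = ∫⁻ x, c * w x ∂μ := (lintegral_const_mul c hw).symm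
      _ = ∫⁻ x, c₁ * (A x * w x) + c₂ * (B x * w x) ∂μ :=
          lintegral_congr fun x => by rw [← hpt x, add_mul, mul_assoc, mul_assoc]
  rw [hc, lintegral_add_left ((hA.fun_mul hw).const_mul c₁), lintegral_const_mul c₁ (hA.fun_mul hw),
    lintegral_const_mul c₂ (hB.fun_mul hw), add_assoc]

/-- **Stub A — energy bookkeeping of the notch** `E(Ψ) + tN²/L³ = F_t(Ψ) + M_t(Ψ)` in `ℝ≥0∞`:
pointwise `(2t/L³)∑_{i<j}(1 - cos θ_ij) + (t/L³)|ρ_k|² = (t/L³)(N(N-1) + N) = tN²/L³` by the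
norm-square identity for the density wave (taken as hypothesis), then `∫ const·|Ψ|² = const`
(normalisation on the cell) and additivity of the lower integral (all integrands measurable:
`Ψ` is `C¹`, `ρ_k` continuous). [folklore] -/
theorem stub_energyAddConst : open MeasureTheory Literature.MathematicalPhysics.QuantumManyBody.BoseGas in ∀ (v : ℝ → ENNReal) (N : ℕ) (L t : ℝ) (m : Fin 3 → ℤ), 0 < L → 0 ≤ t → (∀ X : Fin N → EuclideanSpace ℝ (Fin 3), ‖densityWave N L m X‖ ^ 2 = (N : ℝ) + 2 * ∑ i : Fin N, ∑ j : Fin N with i < j, Real.cos (2 * Real.pi / L * ∑ r : Fin 3, (m r : ℝ) * (X i r - X j r))) → ∀ Ψ : PeriodicTrialState N L, periodicEnergy v Ψ + ENNReal.ofReal (t * (N : ℝ) ^ 2 / L ^ 3) = (periodicEnergy v Ψ + ENNReal.ofReal (2 * t / L ^ 3) * ∫⁻ X in cellN N L, (∑ i : Fin N, ∑ j : Fin N with i < j, ENNReal.ofReal (1 - Real.cos (2 * Real.pi / L * ∑ r : Fin 3, (m r : ℝ) * (X i r - X j r)))) * (‖Ψ.ψ X‖₊ : ENNReal) ^ 2)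 + ENNReal.ofReal (t / L ^ 3) * ∫⁻ X in cellN N L, (‖densityWave N L m X‖₊ : ENNReal) ^ 2 * (‖Ψ.ψ X‖₊ : ENNReal) ^ 2 := by
  intro v N L t m hL ht hρ Ψ
  refine energyAddConst_lintegral (volume.restrict (cellN N L)) (periodicEnergy v Ψ) _ _ _
    (A := fun X : Config N => ∑ i : Fin N, ∑ j : Fin N with i < j,
      ENNReal.ofReal (1 - Real.cos (2 * Real.pi / L * ∑ r : Fin 3, (m r : ℝ) * (X i r - X j r))))
    (B := fun X : Config N => (‖densityWave N L m X‖₊ : ℝ≥0∞) ^ 2)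
    (w := fun X : Config N => (‖Ψ.ψ X‖₊ : ℝ≥0∞) ^ 2) ?_ ?_ ?_ Ψ.norm_eq fun X => ?_
  · refine Finset.measurable_sum _ fun i _ => Finset.measurable_sum _ fun j _ =>
      ENNReal.measurable_ofReal.comp ?_
    fun_prop
  · exact (measurable_densityWave L m).nnnorm.coe_nnreal_ennreal.pow_const 2
  · exact Ψ.contDiff.continuous.measurable.nnnorm.coe_nnreal_ennreal.pow_const 2
  · exact energyAddConst_pointwise N ht hL
      (fun i j => Real.cos (2 * Real.pi / L * ∑ r : Fin 3, (m r : ℝ) * (X i r - X j r)))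
      (fun i j => Real.cos_le_one _) (densityWave N L m X) (hρ X)

end Summit.AtomisticToContinuum.BoseEinsteinCondensation.Theorems

end
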